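import Summits.ValiantsHypothesis.ValiantsHypothesis.Theorems.KPlusLogSqLawLiftingRungFourRangeGRW
import Summits.ValiantsHypothesis.ValiantsHypothesis.Theorems.KPlusLogSqLawLiftingRungFourRangeSq
import Summits.ValiantsHypothesis.ValiantsHypothesis.Theorems.KPlusLogSqLawTropicalGradedWalkChainThree

/-!
# Route «KPlusLogSqLaw», crux `Lifting` / `WeakLifting` — the `K = 4` LIFT rung on the range `m ≤ 24569`
# (Descartes + the kernel GRW floor `2m²`)

HONEST FRAMING.  Helper (partial range, no stub credit) toward the lifting cruxes of route `KPlusLogSqLaw`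
(`Summit.ValiantsHypothesis.ValiantsHypothesis.Theses.KPlusLogSqLaw.Lifting`, item `stmt-ValiantsHypothesis-19772`, which implies
`…KPlusLogSqLaw.WeakLifting`, item `stmt-ValiantsHypothesis-19561`, by `TropicalCensus.weakLifting_of_tropicalLifting`); cell
`pub-symmetroid`, seat val-sym-lift-p3 g22, 2026-08-29.  The tree's `lift_rung_four_of_le_grw` (this lineage, g20) proves the `K = 4` rung
`TropRootLawAt m 4 n → RealRootLawAt m 4 (2^12 (n+1))` for `m ≤ 18000` from the GRW-lite floor `(3m² − 3m)/2 − 1 ≤ T(m,4)`.  The `K = 4`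
tropical row has since received the kernel floor of leading coefficient `2` for EVERY `m ≥ 2` — the full graded-rotation-walk chain of seat
val-sym-trop-p3 (`TropicalCensus.grw3_le_of_tropRootLawAt_four : TropRootLawAt m 4 B → 2·m² ≤ B`).  The same two-line Descartes argument
(`Census.realRootLawAt_descartes`: `ζ_tot(m,4) ≤ 2·C(m+3,3) − 1`, cubic in `m`) then carries the rung to its exact arithmetic edge:

* `lift_rung_four_of_le_grw3 : m ≤ 24569 → TropRootLawAt m 4 n → RealRootLawAt m 4 (2 ^ (3 * 4) * (n + 1))`

(arithmetic: `(m+1)(m+2)(m+3) ≤ 12288·(2m² + 1)` iff `m ≤ 24569`; below `m = 18001` the tree's rung is used verbatim).  This is the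
range extension ANNOUNCED as possible in the docstring of `…LiftingRungFourRangeGRW` («would only move the edge to m ≈ 24500») and it is the
last such extension available from a QUADRATIC tropical floor: with constant `2^(3·4)` the Descartes ceiling `≈ m³/3` overtakes `4096·(c m²)`
at `m ≈ 12288·c`, and slope counting caps every `(m,4)` floor at `C(m+3,3) − 1`.  WHAT THIS IS NOT: the rung for ALL `m` at `K = 4` needs a CUBIC
tropical `(m,4)` family or a sub-Descartes real bound — the cell's open `K = 4` fork (D2); this seat's LP census of «joint-unlocking» odometer
designs for that fork is NEGATIVE (memo `SWITCHBOARD-OBSTRUCTIONS-liftp3g22.md`, evidence on stmt-ValiantsHypothesis-19561).  Nothing here asserts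
`Lifting`, `WeakLifting`, `TropicalB`, `KPlusLogSqLaw`, `MatrixDescartes` (stmt-ValiantsHypothesis-18050) or anything about `VP ≠ VNP`.
Def-free. [folklore] Descartes' rule + arithmetic.
-/

set_option linter.dupNamespace false
set_option autoImplicit false

namespace Summit.ValiantsHypothesis.ValiantsHypothesis.Theorems.KPlusLogSqLaw

open Summit.ValiantsHypothesis.ValiantsHypothesis.Theorems.LacunarySymmetroidMatrixDescartes (RealRootLawAt)
open Summit.ValiantsHypothesis.ValiantsHypothesis.Theorems.LacunarySymmetroidMatrixDescartes.TropicalCensus (TropRootLawAt)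

/-- the cubic-versus-quadratic arithmetic of the range: `(m+3)(m+2)(m+1) ≤ 12288·(2m² + 1)` for `m ≤ 24569`
(and this fails at `m = 24570`). [folklore] -/
theorem range_arith_grw3 (m : ℕ) (hm : m ≤ 24569) :
    (m + 3) * (m + 2) * (m + 1) ≤ 12288 * (2 * m ^ 2 + 1) := by
  have h1 : m * (m * m) ≤ 24569 * (m * m) := Nat.mul_le_mul_right _ hm
  nlinarith [h1, Nat.zero_le m]

/-- **LIFT, rung `K = 4`, on the range `m ≤ 24569` (constant `2^12`):** there the kernel GRW tropical floor `2m² ≤ n`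
(`grw3_le_of_tropRootLawAt_four`) and the cubic real Descartes ceiling `2·C(m+3,3) − 1` fit under `2^12·(n+1)`; below `m = 18001`
this is the tree's `lift_rung_four_of_le_grw`. [folklore] -/
theorem lift_rung_four_of_le_grw3 (m n : ℕ) (hm : m ≤ 24569) (h : TropRootLawAt m 4 n) :
    RealRootLawAt m 4 (2 ^ (3 * 4) * (n + 1)) := by
  by_cases hsmall : m ≤ 18000
  · exact lift_rung_four_of_le_grw m n hsmall h
  have h1 := LacunarySymmetroidMatrixDescartes.TropicalCensus.grw3_le_of_tropRootLawAt_four m n (by omega) h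
  refine LacunarySymmetroidMatrixDescartes.Census.realRootLawAt_mono ?_
    (LacunarySymmetroidMatrixDescartes.Census.realRootLawAt_descartes m 4 (by norm_num))
  have h2 : Nat.choose (m + 4 - 1) m = Nat.choose (m + 3) 3 := by
    rw [show m + 4 - 1 = m + 3 from rfl]
    exact Nat.choose_symm_add
  have h3 := six_mul_choose_three m
  have h4 := range_arith_grw3 m hm
  rw [h2, show 2 ^ (3 * 4) = 4096 by norm_num]
  -- `6·C(m+3,3) = (m+3)(m+2)(m+1) ≤ 12288·(2m²+1) ≤ 12288·(n+1)`, hence `2·C − 1 ≤ 4096·(n+1)`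
  have h5 : 12288 * (2 * m ^ 2 + 1) ≤ 12288 * (n + 1) := Nat.mul_le_mul_left _ (by omega)
  omega

end Summit.ValiantsHypothesis.ValiantsHypothesis.Theorems.KPlusLogSqLaw
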